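import Summits.HodgeConjecture.HodgeConjecture.Theorems.Ring2TransportDivisorGeneratedAnchors
import Literature.AlgebraicGeometry.HodgeTheory.SemiregularVariationalHodgeISemiregular
import Literature.AlgebraicGeometry.HodgeTheory.SupportedLocusClosed
import Literature.AlgebraicGeometry.HodgeTheory.InvariantClassesFromTotalSpaceProofs
import HarnessLib

/-!
# Ring 2 · transport (gen 5) — row T7-germ: the semiregular lift at CM fibres through the REFEREED germ theorem
# (Buchweitz–Flenner 2003, Thm. 5.1) lands in the LOCAL leaf `LocalWeilVHCAtCMQuadratic`

HONEST FRAMING (page 1, verbatim as the cell requires): research route conditional on HC_CM; not a corollary;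
Q11.4-sentence-2 already refuted in dim ≥ 3. `HC_CM` :=
`Summit.HodgeConjecture.HodgeConjecture.Theses.RankFourFaces.CMAbelianHodge` is an explicit HYPOTHESIS (binder
`hCM`) wherever it occurs, never a cited fact; nothing in this file is a case of the Hodge conjecture proved
unconditionally. Markman's preprints [M] arXiv:2502.03415, [S] arXiv:2509.23403, [C] arXiv:2509.23079 and Perry's
[P] arXiv:2604.00511 are UNREFEREED and are cited for statements only; THIS ROW USES NONE OF THEM AS AN INPUT.

## What this file adds (namespace `…Ring2Transport`, re-using gens 1–2 BY NAME)

The companion `Theorems/Ring2TransportSemiregular.lean` (rows (S2), (S3)) composes `HC_CM` with the semiregular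
lift at CM points and PERRY's global statement `Perry2026_semiregularTwisted_remainsAlgebraic` (tree transcription
of an unrefereed claim: algebraic on EVERY fibre over a quasi-projective base). The present file is the variant in
which the literature input is the PUBLISHED GERM theorem only:

* `HodgeTheory.BuchweitzFlenner2003_variationalHodge_ISemiregular` — Buchweitz–Flenner, Compositio Math. 137
  (2003) Thm. 5.1 for a general index set `I` (tree NAMED FACT, refereed, unformalised; used BY NAME as a binder):
  for an `I`-semiregular finite locally free `ℰ₀` on `X_{s₀}` whose `ch_p`, `p ∈ I`, stay of type `(p,p)` along
  paths in a cohomologically locally trivial `U ∋ s₀`, the flat transports of `ch_p(ℰ₀)` are ALGEBRAIC on the fibres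
  over some Euclidean-open `W`, `s₀ ∈ W ⊆ U`.

Passing from the germ `W` to the whole base is NOT asked of the literature here: it is gen 1's job, already
kernel-checked — `HC_WeilClassesQuadratic_of_HC_CM_local` / gen 2's `HC_WeilClassesQuadratic_of_divisorGeneratedCMPointed_local`
propagate a Euclidean-open germ of algebraic fibres through the smooth irreducible quasi-projective base by Baire +
Charles–Schnell (`mem_algebraicClasses_of_isOpen_subset_algebraicityLocus`). So the only thing to supply is gen 1's
local leaf `LocalWeilVHCAtCMQuadratic`, and this file proves

* `localWeilVHCAtCMQuadratic_of_semiregularChernLift` :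
  `BuchweitzFlenner2003_variationalHodge_ISemiregular → SemiregularChernLiftAtCMQuadratic C → LocalWeilVHCAtCMQuadratic`,

where the typed missing input (OURS, open, Summit-side, `@[conjecture]`; NOT a Literature fact) is

* `SemiregularChernLiftAtCMQuadratic C` (H-T3-germ): at a CM-charted fibre `s₀` of a quadratic Weil family on which
  `W|_{𝒳_{s₀}}` is ALGEBRAIC (what `HC_CM`, or gen 2's divisor generation, delivers), `W|_{𝒳_{s₀}}` is a `ℂ`-linear
  combination of middle Chern characters `ch_n(E_i)` of finite locally free sheaves `E_i` on `𝒳_{s₀}` that are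
  `I_i`-semiregular for degree sets `I_i ∋ n`, and whose `ch_p(E_i)`, `p ∈ I_i`, stay of type `(p,p)` along paths in
  some Euclidean-open `U ∋ s₀`. HONEST LABEL (as for the companion's `SemiregularLiftAtCMPoints`, referee ref1 F5):
  PLAUSIBLY FALSE AS A `∀`-STATEMENT — obstructed representatives are generic
  (`HodgeTheory/SemiregularityWeakCriterionAbelianCounterexample.lean`); the preferred form is a per-family witness,
  and the closest print has the semiregular sheaf GIVEN (Bloch 1972 Thm. 7.1, Buchweitz–Flenner 2003 Thm. 5.1,
  Markman [S] Question 11.4 sentence 1 — open). It is the `B = 0`, germ, `ℂ`-linear shape; no `B`-field and no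
  global statement is needed because the propagation is done by gen 1.

and then, by gens 1–2 verbatim,

* `HC_WeilClassesQuadratic_of_HC_CM_of_semiregularChernLift` (T7-germ):
  `HC_CM → CMPointedWeilFamiliesQuadratic → SemiregularChernLiftAtCMQuadratic C →
   BuchweitzFlenner2003_variationalHodge_ISemiregular → WeilClassesImaginaryQuadratic` (R∞, imaginary quadratic), with
  the ledger corollaries stmt-HodgeConjecture-2522 (`TropicalCuspLift.WeilClassesAlgebraic`) and stmt-2524
  (`SevenfoldWeilCensus.WeilSixfolds`);
* `HC_WeilClassesQuadratic_of_divisorGeneratedCMPointed_of_semiregularChernLift` — the `HC_CM`-FREE twin through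
  gen 2's divisor-generated anchors (honest column: for the quadratic rungs `HC_CM` is NOMINAL, gen 2).

Infrastructure proved here (tree-generic, small): `pathIn` (a path with values in a subset, as a path of the
subtype) and `transportFun_pathIn_mono` (parallel transport computed in an open `V ⊆ U` agrees with transport in `U`;
uniqueness of lifts in the étalé space, Voisin I §9.2.1).

References (bib keys): BuchweitzFlenner2003 (§5 Thm. 5.1, Def. 4.1), Bloch1972Semiregularity (Thm. (7.1), Remark
(7.5)), VoisinHodgeI2002 (§9.2.1), VoisinHodgeII2003 (§3.1.2, §5.3.3), CharlesSchnell2014Notes (Conj. 11.3.1,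
Prop. 11.3.11), Markman2025SurveySecant ([S] Question 11.4, §12 — preprint / ICM lecture, unrefereed, statements
only), Deligne1982HodgeCycles (§4–5), vanGeemen1994HodgeAV (6.12).
-/

set_option linter.dupNamespace false

noncomputable section

open CategoryTheory

namespace Summit.HodgeConjecture.HodgeConjecture.Ring2Transport

open Literature.AlgebraicGeometry Literature.AlgebraicGeometry.Motives
open Literature.AlgebraicGeometry.HodgeTheory
open Literature.AlgebraicTopology.SingularHomology
open Literature.AlgebraicGeometry.Milne1999 (IsOfCMType)
open Summit.HodgeConjecture.HodgeConjecture.WeilTypeLadder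
open Summit.HodgeConjecture.HodgeConjecture.Theses


/-! ### §0 Two tree-generic transport lemmas -/

section PathIn

variable {X : Type*} [TopologicalSpace X] {x y : X}

/-- A path all of whose points lie in `A`, viewed as a path of the subtype `A`. [folklore] -/
def pathIn (γ : Path x y) (A : Set X) (h : ∀ r, γ r ∈ A) :
    Path (⟨x, γ.source ▸ h 0⟩ : A) ⟨y, γ.target ▸ h 1⟩ where
  toFun r := ⟨γ r, h r⟩
  continuous_toFun := γ.continuous.subtype_mk _
  source' := Subtype.ext γ.source
  target' := Subtype.ext γ.target

end PathIn

section Transport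

variable {𝒳 S : SchemeOver ℂ} (f : 𝒳 ⟶ S) (k : ℕ)

/-- **Transport computed in an open `V ⊆ U` agrees with transport in `U`** along the same path of `S(ℂ)` (uniqueness
of lifts to the étalé space of `Rᵏ f_* ℂ`; Voisin I §9.2.1). [cite: VoisinHodgeI2002, §9.2.1] -/
theorem transportFun_pathIn_mono {U V : Set (ComplexPoints S)} (hU : IsCohomologicallyLocallyTrivialOn f U)
    (hVU : V ⊆ U) (hVo : IsOpen V) {x y : ComplexPoints S} (γ : Path x y) (hV : ∀ r, γ r ∈ V)
    (α : complexBetti (fiberOver f x) k) :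
    transportFun f k (hU.mono hVU hVo) ⟦pathIn γ V hV⟧ α =
      transportFun f k hU ⟦pathIn γ U fun r ↦ hVU (hV r)⟧ α := by
  obtain ⟨Γ, hΓ⟩ := exists_path_transportFun f k (hU.mono hVU hVo) (pathIn γ V hV) α
  exact (transportFun_eq_of_path f k hU (pathIn γ U fun r ↦ hVU (hV r)) Γ fun u ↦ hΓ u).symm

end Transport

/-! ### §1 The typed missing input: a semiregular CHERN lift at CM fibres (germ, `B = 0`, `ℂ`-linear) -/

/-- **H-T3-germ `SemiregularChernLiftAtCMQuadratic C` (typed missing input; OURS, open, Summit-side — NOT a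
Literature fact).** In the binders of gen 1's `LocalWeilVHCAtCMQuadratic` (`n ≥ 2`, `d ≥ 1`, a smooth projective
`ℚ(√-d)`-Weil family `f : 𝒳 ⟶ S` of relative dimension `2n` over a smooth irreducible quasi-projective base, a
global class `W` fibrewise rational of type `(n,n)` and Weil-confined through charts, a complex point `s₀` whose
fibre is presented by a CM abelian variety, and `W|_{𝒳_{s₀}}` ALGEBRAIC): there are a Euclidean-open `U ∋ s₀`,
finitely many finite locally free sheaves `E_i` on `𝒳_{s₀}` with finite degree sets `I_i ∋ n` such that `E_i` is
`I_i`-semiregular in the sense of Buchweitz–Flenner (`IsISemiregular`, joint injectivity of `(σ_{p-1})_{p ∈ I_i}` on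
`Ext²(E_i,E_i)`), complex coefficients `c_i` with `W|_{𝒳_{s₀}} = Σ_i c_i · ch_n(E_i)` for the Chern character theory
`C`, and, for every `i` and `p ∈ I_i`, the flat transport of `ch_p(E_i)` along every path in `U` from `s₀` is of
type `(p,p)` — exactly the hypothesis package of `BuchweitzFlenner2003_variationalHodge_ISemiregular`, `ℂ`-linearly
extended. CLOSEST PRINT — all with the semiregular sheaf GIVEN, none producing it from algebraicity —: Bloch,
Invent. Math. 17 (1972) Thm. (7.1); Buchweitz–Flenner, Compositio Math. 137 (2003) Thm. 5.1; Markman [S]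
Question 11.4 SENTENCE 1 (open; sentence 2, the weak criterion, is REFUTED for abelian varieties of dimension ≥ 3,
`SemiregularityWeakCriterionAbelianCounterexampleFull`). HONEST LABEL: PLAUSIBLY FALSE AS A `∀`-STATEMENT
(obstructed representatives are generic); the preferred form is a per-family witness; NOT a case of HC (its
conclusion asserts sheaves); no on-path lemma. NOT asserted. [cite: BuchweitzFlenner2003, §5 Thm. 5.1 and Def. 4.1]
[cite: Bloch1972Semiregularity, Thm. (7.1) and Remark (7.5)]
[cite: Markman2025SurveySecant, Question 11.4 sentence 1 and §12 (preprint / ICM 2026 lecture, unrefereed)] [status: open] -/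
@[conjecture] def SemiregularChernLiftAtCMQuadratic (C : ChernCharacterBetti) : Prop :=
  ∀ (n : ℕ), 2 ≤ n → ∀ (d : ℕ), 0 < d →
    ∀ ⦃𝒳 S : Motives.SchemeOver ℂ⦄ (f : 𝒳 ⟶ S), Motives.IsSmoothProjectiveFamily f (2 * n) →
      IsQuasiProjectiveOver 𝒳 → IsQuasiProjectiveOver S → IrreducibleSpace S.left →
      AlgebraicGeometry.Smooth S.hom →
      ∀ (W : complexBetti 𝒳 (2 * n)),
        (∀ s : Motives.ComplexPoints S,
          IsRationalClass (complexBetti.map (Motives.fiberι f s) (2 * n) W) ∧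
            IsOfHodgeType (2 * n) (Motives.fiberOver f s) (2 * n) n n
              (complexBetti.map (Motives.fiberι f s) (2 * n) W)) →
        (∀ s : Motives.ComplexPoints S, ∃ (A' : Motives.AbelianVariety ℂ) (φ' : A' ⟶ A')
            (e' : A'.X ≅ Motives.fiberOver f s),
          A'.dim = 2 * n ∧ φ' ≫ φ' = -(d • 𝟙 A') ∧
            complexBetti.map e'.hom (2 * n) (complexBetti.map (Motives.fiberι f s) (2 * n) W) ∈
              weilClassesOf A' φ' n d) →
        ∀ s₀ : Motives.ComplexPoints S,
          (∃ A₀ : Motives.AbelianVariety ℂ,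
              Nonempty (A₀.X ≅ Motives.fiberOver f s₀) ∧ A₀.dim = 2 * n ∧ IsOfCMType A₀) →
          complexBetti.map (Motives.fiberι f s₀) (2 * n) W ∈ algebraicClasses (Motives.fiberOver f s₀) n →
          ∃ (U : Set (Motives.ComplexPoints S)) (hs₀ : s₀ ∈ U), IsOpen U ∧
            ∃ (r : ℕ) (c : Fin r → ℂ) (E : Fin r → (Motives.fiberOver f s₀).left.Modules)
              (hE : ∀ i, Motives.IsFiniteLocallyFree (E i)) (Ideg : Fin r → Finset ℕ),
              (∀ i, n ∈ Ideg i) ∧ (∀ i, IsISemiregular (hE i) {q | q + 1 ∈ Ideg i}) ∧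
              complexBetti.map (Motives.fiberι f s₀) (2 * n) W =
                  ∑ i, c i • C.ch (Motives.fiberOver f s₀) (E i) n ∧
              ∀ (hU : IsCohomologicallyLocallyTrivialOn f U) (i : Fin r), ∀ p ∈ Ideg i,
                ∀ (t : U) (γ : Path.Homotopic.Quotient (⟨s₀, hs₀⟩ : U) t),
                  IsOfHodgeType (2 * n) (Motives.fiberOver f t.1) (2 * p) p p
                    (transportFun f (2 * p) hU γ (C.ch (Motives.fiberOver f s₀) (E i) p))

/-! ### §2 The refereed germ theorem transports the lift into gen 1's local leaf -/

/-- **`LocalWeilVHCAtCMQuadratic` from the semiregular Chern lift at CM fibres and Buchweitz–Flenner's theorem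
(kernel-checked composition; literature input REFEREED).** At a CM-charted algebraic fibre `s₀`: write
`W|_{s₀} = Σ c_i ch_n(E_i)` (H-T3-germ); the whole base is cohomologically locally trivial
(`isCohomologicallyLocallyTrivialOn_univ_of_isQuasiProjectiveOver`, Ehresmann), so Buchweitz–Flenner Thm. 5.1
gives opens `W_i ∋ s₀` over which the transports of `ch_n(E_i)` are algebraic; on the path component `V` of `s₀` in
`U ∩ ⋂ W_i` (open: `S(ℂ)` is locally path connected, `locallyPathConnectedSpace_complexPoints_of_smooth`) every `t`
is joined to `s₀` by a path `γ ⊂ V`, and `W|_{𝒳_t} = γ_*(W|_{s₀}) = Σ c_i γ_*(ch_n E_i)` (restrictions of global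
classes are flat, `transportFun_map_fiberι`; transport is `ℂ`-linear) is algebraic. [cite: BuchweitzFlenner2003, §5 Thm. 5.1]
[cite: VoisinHodgeI2002, §9.2.1] [cite: VoisinHodgeII2003, §3.1.2] -/
theorem localWeilVHCAtCMQuadratic_of_semiregularChernLift (C : ChernCharacterBetti)
    (hBF : BuchweitzFlenner2003_variationalHodge_ISemiregular)
    (hL : SemiregularChernLiftAtCMQuadratic C) : LocalWeilVHCAtCMQuadratic := by
  intro n hn d hd 𝒳 S f hf hq𝒳 hqS hirr hsm W hW hch s₀ hA₀ halg
  obtain ⟨U, hs₀U, hUo, r, c, E, hE, Ideg, hnI, hsr, hsum, hHodge⟩ :=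
    hL n hn d hd f hf hq𝒳 hqS hirr hsm W hW hch s₀ hA₀ halg
  have hU : IsCohomologicallyLocallyTrivialOn f U :=
    (isCohomologicallyLocallyTrivialOn_univ_of_isQuasiProjectiveOver f hf hqS hsm).mono (Set.subset_univ U) hUo
  -- Buchweitz–Flenner, sheaf by sheaf
  have hBFi : ∀ i : Fin r, ∃ (Wi : Set (ComplexPoints S)) (hWo : IsOpen Wi) (hW₀ : s₀ ∈ Wi) (hWU : Wi ⊆ U),
      ∀ (t : Wi) (γ : Path.Homotopic.Quotient (⟨s₀, hW₀⟩ : Wi) t),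
        transportFun f (2 * n) (hU.mono hWU hWo) γ (C.ch (fiberOver f s₀) (E i) n) ∈
          algebraicClasses (fiberOver f t.1) n := by
    intro i
    obtain ⟨Wi, hWo, hW₀, hWU, h⟩ := hBF C f (2 * n) hf hsm hU ⟨s₀, hs₀U⟩ (E i) (hE i) (Ideg i) (hsr i)
      (fun p hp t γ ↦ hHodge hU i p hp t γ)
    exact ⟨Wi, hWo, hW₀, hWU, fun t γ ↦ h n (hnI i) t γ⟩
  choose Wi hWio hW₀i hWiU hWialg using hBFi
  -- the path component of `s₀` in `U ∩ ⋂ Wi`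
  haveI := hsm
  haveI : LocallyPathConnectedSpace (ComplexPoints S) := locallyPathConnectedSpace_complexPoints_of_smooth S
  set W₀ : Set (ComplexPoints S) := U ∩ ⋂ i, Wi i with hW₀def
  have hW₀o : IsOpen W₀ := hUo.inter (isOpen_iInter_of_finite hWio)
  have hs₀W₀ : s₀ ∈ W₀ := ⟨hs₀U, Set.mem_iInter.2 hW₀i⟩
  refine ⟨pathComponentIn W₀ s₀, hW₀o.pathComponentIn s₀, mem_pathComponentIn_self hs₀W₀, fun t ht ↦ ?_⟩
  have hJ : JoinedIn W₀ s₀ t := ht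
  set γ₀ : Path s₀ t := hJ.somePath
  have hγ : ∀ ρ, γ₀ ρ ∈ W₀ := hJ.somePath_mem
  have hγU : ∀ ρ, γ₀ ρ ∈ U := fun ρ ↦ (hγ ρ).1
  have hγi : ∀ i ρ, γ₀ ρ ∈ Wi i := fun i ρ ↦ Set.mem_iInter.1 (hγ ρ).2 i
  -- `W|_{𝒳_t}` is the transport of `W|_{𝒳_{s₀}}` along `γ₀` (in `U`)
  have hWt : complexBetti.map (fiberι f t) (2 * n) W =
      transportFun f (2 * n) hU ⟦pathIn γ₀ U hγU⟧ (complexBetti.map (fiberι f s₀) (2 * n) W) :=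
    (transportFun_map_fiberι f (2 * n) hU ⟦pathIn γ₀ U hγU⟧ W).symm
  have hlin : transportFun f (2 * n) hU ⟦pathIn γ₀ U hγU⟧ (∑ i, c i • C.ch (fiberOver f s₀) (E i) n) =
      ∑ i, c i • transportFun f (2 * n) hU ⟦pathIn γ₀ U hγU⟧ (C.ch (fiberOver f s₀) (E i) n) := by
    simp only [← transportLinear_apply, map_sum, map_smul]
  rw [hWt, hsum, hlin]
  refine Submodule.sum_mem _ fun i _ ↦ Submodule.smul_mem _ (c i) ?_
  have hi := hWialg i ⟨t, hγi i 1 |> fun h ↦ γ₀.target ▸ h⟩ ⟦pathIn γ₀ (Wi i) (hγi i)⟧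
  rw [transportFun_pathIn_mono f (2 * n) hU (hWiU i) (hWio i) γ₀ (hγi i)] at hi
  exact hi

/-! ### §3 Row T7-germ and its `HC_CM`-free twin (gens 1–2 verbatim downstream) -/

/-- **T7-germ — `HC_CM` + CM-pointed quadratic Weil families + the semiregular Chern lift at CM fibres +
Buchweitz–Flenner ⟹ R∞ (imaginary quadratic).** Kernel-checked composition of gen 1's
`HC_WeilClassesQuadratic_of_HC_CM_local` with `localWeilVHCAtCMQuadratic_of_semiregularChernLift`. CONDITIONAL on
`HC_CM` (binder), two open Summit-side hypotheses (ours) and one refereed named fact (Buchweitz–Flenner 2003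
Thm. 5.1, unformalised). No preprint is an input of this row. ON-PATH lemma of the target = tree
`WeilTypeLadder.weilClassesImaginaryQuadratic_of_hodgeConjecture`. [cite: BuchweitzFlenner2003, §5 Thm. 5.1]
[cite: CharlesSchnell2014Notes, Prop. 11.3.11 (proof)] [cite: Deligne1982HodgeCycles, §5] -/
theorem HC_WeilClassesQuadratic_of_HC_CM_of_semiregularChernLift (C : ChernCharacterBetti)
    (hCM : Theses.RankFourFaces.CMAbelianHodge) (hP : CMPointedWeilFamiliesQuadratic)
    (hL : SemiregularChernLiftAtCMQuadratic C) (hBF : BuchweitzFlenner2003_variationalHodge_ISemiregular) :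
    WeilClassesImaginaryQuadratic :=
  HC_WeilClassesQuadratic_of_HC_CM_local hCM hP (localWeilVHCAtCMQuadratic_of_semiregularChernLift C hBF hL)

/-- stmt-HodgeConjecture-2522 (`TropicalCuspLift.WeilClassesAlgebraic`) on row T7-germ. [cite: Weil1977HodgeRing, pp. 421–429]
[cite: BuchweitzFlenner2003, §5 Thm. 5.1] -/
theorem HC_WeilClassesAlgebraic_of_HC_CM_of_semiregularChernLift (C : ChernCharacterBetti)
    (hCM : Theses.RankFourFaces.CMAbelianHodge) (hP : CMPointedWeilFamiliesQuadratic)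
    (hL : SemiregularChernLiftAtCMQuadratic C) (hBF : BuchweitzFlenner2003_variationalHodge_ISemiregular) :
    Theses.TropicalCuspLift.WeilClassesAlgebraic :=
  HC_WeilClassesAlgebraic_of_HC_CM hCM hP (localWeilVHCAtCMQuadratic_of_semiregularChernLift C hBF hL)

/-- stmt-HodgeConjecture-2524 (`SevenfoldWeilCensus.WeilSixfolds`) on row T7-germ.
[cite: Markman2025SurveySecant, Thm. 1.2 and §11.5 (preprint / ICM 2026 lecture, unrefereed; statement only)]
[cite: BuchweitzFlenner2003, §5 Thm. 5.1] -/
theorem HC_WeilSixfolds_of_HC_CM_of_semiregularChernLift (C : ChernCharacterBetti)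
    (hCM : Theses.RankFourFaces.CMAbelianHodge) (hP : CMPointedWeilFamiliesQuadratic)
    (hL : SemiregularChernLiftAtCMQuadratic C) (hBF : BuchweitzFlenner2003_variationalHodge_ISemiregular) :
    Theses.SevenfoldWeilCensus.WeilSixfolds :=
  HC_WeilSixfolds_of_HC_CM hCM hP (localWeilVHCAtCMQuadratic_of_semiregularChernLift C hBF hL)

/-- **The `HC_CM`-FREE twin of T7-germ** through gen 2's divisor-generated CM anchors
(`DivisorGeneratedCMPointedWeilFamiliesQuadratic`; honest column of the cell: on the quadratic rungs the CM fibre's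
algebraicity is Lefschetz (1,1), so `HC_CM` is NOMINAL). [cite: Gordon1997, §3 Theorem] [cite: BuchweitzFlenner2003, §5 Thm. 5.1] -/
theorem HC_WeilClassesQuadratic_of_divisorGeneratedCMPointed_of_semiregularChernLift (C : ChernCharacterBetti)
    (hP : DivisorGeneratedCMPointedWeilFamiliesQuadratic)
    (hL : SemiregularChernLiftAtCMQuadratic C) (hBF : BuchweitzFlenner2003_variationalHodge_ISemiregular) :
    WeilClassesImaginaryQuadratic :=
  HC_WeilClassesQuadratic_of_divisorGeneratedCMPointed_local hP (localWeilVHCAtCMQuadratic_of_semiregularChernLift C hBF hL)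

/-- **Position of row T7-germ** (kernel-checked conjunction): the local leaf it reaches is a case of the summit
(gen 1's on-path lemma) and is implied by R∞var; the row's literature input is the refereed germ theorem only.
[cite: CharlesSchnell2014Notes, Conj. 11.3.1 and Cor. 11.3.6] [cite: BuchweitzFlenner2003, §5 Thm. 5.1] -/
theorem semiregularChernLift_position (C : ChernCharacterBetti) :
    (_root_.HodgeConjecture → LocalWeilVHCAtCMQuadratic) ∧
    (WeilVariationalHodgeQuadratic → LocalWeilVHCAtCMQuadratic) ∧
    (BuchweitzFlenner2003_variationalHodge_ISemiregular → SemiregularChernLiftAtCMQuadratic C →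
      LocalWeilVHCAtCMQuadratic) :=
  ⟨localWeilVHCAtCMQuadratic_of_hodgeConjecture, localWeilVHCAtCMQuadratic_of_weilVariationalHodgeQuadratic,
    localWeilVHCAtCMQuadratic_of_semiregularChernLift C⟩

/-! ## Audit: nothing is decided here — every theorem whose conclusion is a Weil rung has among its hypotheses an
OPEN statement (`SemiregularChernLiftAtCMQuadratic`, ours; the CM-pointed families, ours), the refereed but
unformalised fact `BuchweitzFlenner2003_variationalHodge_ISemiregular`, and on the T7-germ rows `HC_CM` by name. -/

#print axioms Summit.HodgeConjecture.HodgeConjecture.Ring2Transport.localWeilVHCAtCMQuadratic_of_semiregularChernLift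
#print axioms Summit.HodgeConjecture.HodgeConjecture.Ring2Transport.HC_WeilClassesQuadratic_of_HC_CM_of_semiregularChernLift

end Summit.HodgeConjecture.HodgeConjecture.Ring2Transport

end
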